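import Literature.Probability.Distributions.PoissonBinomialSmoothness
import Literature.Combinatorics.StablePolynomials.RealRootedBernoulliSum
import HarnessLib

/-!
# Higher differences of a Poisson-binomial law: `‖Δ^j L(W)‖₁ ≤ (C j / Var W)^{j/2}`

Röllin–Ross smoothness calculus for the law of a sum `W` of independent Bernoulli variables
(parameters `p_1, …, p_N ∈ [0,1]`, variance `V = Σ p_k(1−p_k)`), in generating-polynomial form: the
law is the coefficient sequence of `G_{ps}(X) = Π_k ((1 − p_k) + p_k X)` (tree:
`coeff_bernoulliProd_eq_pmf`, `RealRootedBernoulliSum.lean` — this is Lange's table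
`PoissonBinomial.pmf ps`), the `j`-th (backward) difference of the law is the
coefficient sequence of `(1 − X)^j · G_{ps}(X)` (`coeff_one_sub_X_pow_mul`), and its total variation
`D_j = Σ_n |coeff_n ((1−X)^j G_{ps})|` is controlled by:

* §1 `absCoeffSum` calculus (the `ℓ¹` norm of the coefficient sequence, written out as a `Finset`
  sum — no new definition): **`absCoeffSum_mul_le`** (`‖PQ‖₁ ≤ ‖P‖₁‖Q‖₁`: Röllin–Ross Lemma 3.4,
  `D_{n₁+n₂}(X+Y) ≤ D_{n₁}(X) D_{n₂}(Y)` for independent `X, Y`), `absCoeffSum_one_sub_X_mul`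
  (`‖(1−X)P‖₁ = |q_0| + Σ_i |q_{i+1} − q_i|`).
* §2 the generating polynomial: `absCoeffSum_genPoly = 1`,
  **`absCoeffSum_one_sub_X_mul_genPoly_le`** (`D_1 ≤ 2√192/√V`, from `PoissonBinomialSmoothness`).
* §3 BLOCKS: **`absCoeffSum_blocks_le`** — for parameter blocks `B_1, …, B_j` (and a remainder),
  `D_j(L(W)) ≤ Π_l D_1(L(W_{B_l})) ≤ Π_l 2√192/√V(B_l)` (Röllin–Ross Lemma 3.4 iterated, the proof
  of their Thm 4.2); `exists_prefix_blocks` — greedy prefix blocks of variance `≥ θ` exist as long as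
  `jθ + (j−1)/4 ≤ V` (each parameter contributes `≤ 1/4`).
* §4 **`absCoeffSum_one_sub_X_pow_mul_genPoly_le`** — THE BOUND: for `1 ≤ j ≤ 2V + 1`,
  `Σ_n |Δ^j q (n)| ≤ (2√192 · √(2j/V))^j = (1536 j/V)^{j/2}`; and the trivial `≤ 2^j`
  (`absCoeffSum_one_sub_X_pow_mul_genPoly_le_two_pow`). The shape `(Cj/V)^{j/2}` is Röllin–Ross
  Thm 4.2's `D_k ≲ (8k/(πuN))^{k/2}` for embedded Bernoulli sums; constants are not optimised.
* §5 **`hypergeometric_absCoeffSum_le`** — THE HYPERGEOMETRIC CASE: by the tree's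
  `exists_bernoulliProd_eq_hyperGen` / `sum_mul_one_sub_eq_of_hyperGen_eq` (Vatutin–Mikhailov: the
  hypergeometric law is Poisson-binomial, with variance `V = r b d (b+d−r)/((b+d)²(b+d−1))`),
  `Σ_n |coeff_n((1−X)^j H_{b,d,r})| ≤ C(b+d,r)·(2√192·√(2j/V))^j` for `1 ≤ j ≤ 2V+1`, and `≤ C(b+d,r)·2^j`.

Cell pnp-psdrank (LIT-44 §5 link (c3), LIT-45 (S4), prover g21): this is the `x`-smoothness of the
conditional hypergeometric components of the shell laws of block statistics (`ShellLawLevelStep` §9–§10).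
Purely algebraic; no measure theory.

## References
* [RollinRoss2010] A. Röllin, N. Ross, *Local limit theorems via Landau–Kolmogorov inequalities*,
  Bernoulli 21 (2015) 851–880 (arXiv:1011.3100), §3 Lemma 3.1, 3.4, 3.5; §4.1 Thm 4.2.
* [Lange2010] K. Lange, *Numerical Analysis for Statisticians* (2010), §1.7 eq. (1.4).
* [VatutinMikhailov1983] V. A. Vatutin, V. G. Mikhailov, Theory Probab. Appl. 27 (1983) 734–743, §2.
-/

namespace Literature.Probability.Distributions

open Finset Polynomial
open Literature.Combinatorics.StablePolynomials (coeff_bernoulliProd_eq_pmf natDegree_bernoulliProd_le hyperGen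
  exists_bernoulliProd_eq_hyperGen sum_mul_one_sub_eq_of_hyperGen_eq)

/-! ## §1 The `ℓ¹` norm of a coefficient sequence -/

namespace PoissonBinomial

/-- The `ℓ¹` norm of the coefficients does not see where the range is cut, once past the degree.
[cite: RollinRoss2010, §3 (Lemma 3.1: the measure `D_n` as an `ℓ¹` norm)] -/
theorem absCoeffSum_eq_of_le (P : ℝ[X]) {m : ℕ} (hm : P.natDegree ≤ m) :
    ∑ i ∈ range (P.natDegree + 1), |P.coeff i| = ∑ i ∈ range (m + 1), |P.coeff i| := by
  refine (sum_subset (range_subset_range.2 (by omega)) fun _ hi hi' => ?_)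
  rw [coeff_eq_zero_of_natDegree_lt (by simp at hi hi'; omega), abs_zero]

/-- The polynomial with the absolute values of the coefficients (bookkeeping for `‖PQ‖₁ ≤ ‖P‖₁‖Q‖₁`):
its coefficients. [cite: RollinRoss2010, §3 Lemma 3.4] -/
theorem coeff_sum_C_abs_mul_X_pow (P : ℝ[X]) {m : ℕ} (hm : P.natDegree ≤ m) (n : ℕ) :
    (∑ i ∈ range (m + 1), C |P.coeff i| * X ^ i).coeff n = |P.coeff n| := by
  rw [finsetSum_coeff]
  simp only [coeff_C_mul, coeff_X_pow, mul_ite, mul_one, mul_zero]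
  rw [sum_ite_eq]
  split_ifs with h
  · rfl
  · rw [coeff_eq_zero_of_natDegree_lt (by simp at h; omega), abs_zero]

/-- Degree of the absolute-value polynomial. [cite: RollinRoss2010, §3 Lemma 3.4] -/
theorem natDegree_sum_C_abs_mul_X_pow_le (P : ℝ[X]) (m : ℕ) :
    (∑ i ∈ range (m + 1), C |P.coeff i| * X ^ i).natDegree ≤ m :=
  natDegree_sum_le_of_forall_le _ _ fun k hk =>
    (natDegree_C_mul_X_pow_le |P.coeff k| k).trans (Nat.lt_succ_iff.1 (mem_range.1 hk))

/-- Value at `1` of the absolute-value polynomial = the `ℓ¹` norm. [cite: RollinRoss2010, §3 Lemma 3.4] -/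
theorem eval_one_sum_C_abs_mul_X_pow (P : ℝ[X]) (m : ℕ) :
    (∑ i ∈ range (m + 1), C |P.coeff i| * X ^ i).eval 1 = ∑ i ∈ range (m + 1), |P.coeff i| := by
  rw [eval_finsetSum]
  simp

/-- **Röllin–Ross Lemma 3.4 in generating-polynomial form: `‖P·Q‖₁ ≤ ‖P‖₁ · ‖Q‖₁`** (for laws of
independent `X ∼ P`, `Y ∼ Q`: `D_{n₁+n₂}(X + Y) ≤ D_{n₁}(X) · D_{n₂}(Y)`, applied to `(1−X)^{n₁}P` and
`(1−X)^{n₂}Q`). [cite: RollinRoss2010, §3 Lemma 3.4] -/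
theorem absCoeffSum_mul_le (P Q : ℝ[X]) :
    ∑ i ∈ range ((P * Q).natDegree + 1), |(P * Q).coeff i| ≤
      (∑ i ∈ range (P.natDegree + 1), |P.coeff i|) * ∑ i ∈ range (Q.natDegree + 1), |Q.coeff i| := by
  set m := P.natDegree
  set m' := Q.natDegree
  set Pa : ℝ[X] := ∑ i ∈ range (m + 1), C |P.coeff i| * X ^ i with hPa
  set Qa : ℝ[X] := ∑ i ∈ range (m' + 1), C |Q.coeff i| * X ^ i with hQa
  have hdeg : (P * Q).natDegree ≤ m + m' := natDegree_mul_le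
  have hdega : (Pa * Qa).natDegree < m + m' + 1 :=
    Nat.lt_succ_of_le (natDegree_mul_le.trans (add_le_add (natDegree_sum_C_abs_mul_X_pow_le P m)
      (natDegree_sum_C_abs_mul_X_pow_le Q m')))
  rw [absCoeffSum_eq_of_le (P * Q) hdeg, ← eval_one_sum_C_abs_mul_X_pow P m,
    ← eval_one_sum_C_abs_mul_X_pow Q m', ← eval_mul, eval_eq_sum_range' hdega]
  simp only [one_pow, mul_one]
  refine sum_le_sum fun n _ => ?_
  rw [coeff_mul, coeff_mul]
  refine (abs_sum_le_sum_abs _ _).trans (le_of_eq (sum_congr rfl fun x _ => ?_))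
  rw [hPa, hQa, coeff_sum_C_abs_mul_X_pow P le_rfl, coeff_sum_C_abs_mul_X_pow Q le_rfl, abs_mul]

/-- Coefficients of `(1 − X)·P`: the first (backward) difference of the coefficient sequence.
[cite: RollinRoss2010, §3 (Lemma 3.1)] -/
theorem coeff_one_sub_X_mul_succ (P : ℝ[X]) (n : ℕ) : ((1 - X) * P).coeff (n + 1) = P.coeff (n + 1) - P.coeff n := by
  simp [sub_mul, coeff_X_mul]

/-- Constant coefficient of `(1 − X)·P`. [cite: RollinRoss2010, §3 (Lemma 3.1)] -/
theorem coeff_one_sub_X_mul_zero (P : ℝ[X]) : ((1 - X) * P).coeff 0 = P.coeff 0 := by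
  simp [sub_mul]

/-- Degree of `(1 − X)·P`. [cite: RollinRoss2010, §3 (Lemma 3.1)] -/
theorem natDegree_one_sub_X_mul_le (P : ℝ[X]) {N : ℕ} (hN : P.natDegree ≤ N) : ((1 - X) * P).natDegree ≤ N + 1 := by
  refine natDegree_mul_le.trans ?_
  have : (1 - X : ℝ[X]).natDegree ≤ 1 := by compute_degree!
  omega

/-- **`‖(1 − X)·P‖₁ = |q_0| + Σ_{i ≤ N} |q_{i+1} − q_i|`** for `deg P ≤ N` (the total variation of the
first difference, boundary term included). [cite: RollinRoss2010, §3 (Lemma 3.1: `D_1 = ‖Δ L(W)‖`)] -/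
theorem absCoeffSum_one_sub_X_mul (P : ℝ[X]) {N : ℕ} (hN : P.natDegree ≤ N) :
    ∑ i ∈ range (((1 - X) * P).natDegree + 1), |((1 - X) * P).coeff i| =
      |P.coeff 0| + ∑ i ∈ range (N + 1), |P.coeff (i + 1) - P.coeff i| := by
  rw [absCoeffSum_eq_of_le _ (natDegree_one_sub_X_mul_le P hN), sum_range_succ', coeff_one_sub_X_mul_zero, add_comm]
  simp only [coeff_one_sub_X_mul_succ]

/-- `‖(1 − X)·P‖₁ ≤ 2‖P‖₁`. [cite: RollinRoss2010, §3 (Lemma 3.1: `D_{n+1} ≤ 2 D_n`)] -/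
theorem absCoeffSum_one_sub_X_mul_le (P : ℝ[X]) :
    ∑ i ∈ range (((1 - X) * P).natDegree + 1), |((1 - X) * P).coeff i| ≤
      2 * ∑ i ∈ range (P.natDegree + 1), |P.coeff i| := by
  refine (absCoeffSum_mul_le (1 - X) P).trans (mul_le_mul_of_nonneg_right ?_ (sum_nonneg fun i _ => abs_nonneg _))
  -- `‖1 − X‖₁ = 2`
  have hdeg : (1 - X : ℝ[X]).natDegree ≤ 1 := by compute_degree!
  rw [absCoeffSum_eq_of_le _ hdeg]
  simp [sum_range_succ, coeff_one, coeff_X]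
  norm_num

/-- Coefficients of `(1 − X)^j · P` = the `j`-th backward difference of the (zero-extended) coefficient
sequence: `Σ_{i ≤ j} (−1)^i C(j,i) q_{n−i}`. [cite: RollinRoss2010, §3 (Lemma 3.1)] -/
theorem coeff_one_sub_X_pow_mul (P : ℝ[X]) (j n : ℕ) :
    ((1 - X) ^ j * P).coeff n =
      ∑ i ∈ range (j + 1), (-1 : ℝ) ^ i * (j.choose i : ℝ) * (if i ≤ n then P.coeff (n - i) else 0) := by
  have hbin : (1 - X : ℝ[X]) ^ j = ∑ i ∈ range (j + 1), C ((-1 : ℝ) ^ i * (j.choose i : ℝ)) * X ^ i := by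
    rw [sub_eq_add_neg, add_comm, add_pow]
    refine sum_congr rfl fun i _ => ?_
    rw [one_pow, mul_one, neg_pow, C_mul, C_pow, C_neg, C_1, map_natCast]
    ring
  rw [hbin, sum_mul, finsetSum_coeff]
  refine sum_congr rfl fun i _ => ?_
  rw [mul_assoc, coeff_C_mul, coeff_X_pow_mul']

/-! ## §2 The generating polynomial `Π ((1 − p_k) + p_k X)` of a Poisson-binomial law -/

/-- `‖G_{ps}‖₁ = 1`: the coefficients are a probability sequence. [cite: Lange2010, §1.7 eq. (1.4)] -/
theorem absCoeffSum_genPoly (ps : List ℝ) (hps : ∀ p ∈ ps, 0 ≤ p ∧ p ≤ 1) :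
    ∑ i ∈ range (((ps.map fun p => C (1 - p) + C p * X).prod).natDegree + 1),
      |((ps.map fun p => C (1 - p) + C p * X).prod).coeff i| = 1 := by
  rw [absCoeffSum_eq_of_le _ (natDegree_bernoulliProd_le ps)]
  simp only [coeff_bernoulliProd_eq_pmf]
  rw [sum_congr rfl fun i _ => abs_of_nonneg (pmf_nonneg ps hps i)]
  exact sum_pmf ps

/-- Generating polynomial of a concatenation = product. [cite: Lange2010, §1.7 eq. (1.4)] -/
theorem genPoly_append (ps qs : List ℝ) :
    ((ps ++ qs).map fun p => C (1 - p) + C p * X).prod =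
      ((ps.map fun p => C (1 - p) + C p * X).prod) * ((qs.map fun p => C (1 - p) + C p * X).prod) := by
  rw [List.map_append, List.prod_append]

/-- **`D_1` of a Poisson-binomial law in generating-polynomial form**: `‖(1 − X) G_{ps}‖₁ ≤ 2√192/√V`
for `V = Σ p_k(1−p_k) > 0`. [cite: RollinRoss2010, §3 Lemma 3.5 (the `V^{-1/2}` rate, here with a crude constant)] -/
theorem absCoeffSum_one_sub_X_mul_genPoly_le (ps : List ℝ) (hps : ∀ p ∈ ps, 0 ≤ p ∧ p ≤ 1)
    (hV : 0 < (ps.map fun p => p * (1 - p)).sum) :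
    ∑ i ∈ range (((1 - X) * (ps.map fun p => C (1 - p) + C p * X).prod).natDegree + 1),
      |((1 - X) * (ps.map fun p => C (1 - p) + C p * X).prod).coeff i| ≤
      2 * (Real.sqrt 192 / Real.sqrt ((ps.map fun p => p * (1 - p)).sum)) := by
  rw [absCoeffSum_one_sub_X_mul _ (natDegree_bernoulliProd_le ps)]
  simp only [coeff_bernoulliProd_eq_pmf]
  rw [abs_of_nonneg (pmf_nonneg ps hps 0)]
  exact tv_pmf_le_of_variance ps hps hV

/-- The trivial `‖(1 − X) G_{ps}‖₁ ≤ 2`. [cite: RollinRoss2010, §3 Lemma 3.1] -/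
theorem absCoeffSum_one_sub_X_mul_genPoly_le_two (ps : List ℝ) (hps : ∀ p ∈ ps, 0 ≤ p ∧ p ≤ 1) :
    ∑ i ∈ range (((1 - X) * (ps.map fun p => C (1 - p) + C p * X).prod).natDegree + 1),
      |((1 - X) * (ps.map fun p => C (1 - p) + C p * X).prod).coeff i| ≤ 2 := by
  rw [absCoeffSum_one_sub_X_mul _ (natDegree_bernoulliProd_le ps)]
  simp only [coeff_bernoulliProd_eq_pmf]
  rw [abs_of_nonneg (pmf_nonneg ps hps 0)]
  exact tv_pmf_le_two ps hps

/-! ## §3 Blocks: `D_j ≤ Π_l D_1(block_l)` and the greedy prefix blocks -/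

/-- **Röllin–Ross Lemma 3.4 iterated over blocks** (the mechanism of their Thm 4.2): for parameter
blocks `B_1, …, B_j` followed by a remainder, all parameters in `[0,1]`,
`‖(1 − X)^j · G_{B_1 ⋯ B_j rest}‖₁ ≤ Π_l ‖(1 − X) G_{B_l}‖₁`. [cite: RollinRoss2010, §3 Lemma 3.4, §4.1 Thm 4.2 (proof)] -/
theorem absCoeffSum_blocks_le_prod (blocks : List (List ℝ)) (rest : List ℝ)
    (hps : ∀ p ∈ blocks.flatten ++ rest, 0 ≤ p ∧ p ≤ 1) :
    ∑ i ∈ range (((1 - X) ^ blocks.length * ((blocks.flatten ++ rest).map fun p => C (1 - p) + C p * X).prod).natDegree + 1),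
      |((1 - X) ^ blocks.length * ((blocks.flatten ++ rest).map fun p => C (1 - p) + C p * X).prod).coeff i| ≤
      (blocks.map fun B => ∑ i ∈ range (((1 - X) * (B.map fun p => C (1 - p) + C p * X).prod).natDegree + 1),
        |((1 - X) * (B.map fun p => C (1 - p) + C p * X).prod).coeff i|).prod := by
  induction blocks with
  | nil =>
      simp only [List.length_nil, pow_zero, one_mul, List.flatten_nil, List.nil_append, List.map_nil, List.prod_nil]
      exact (absCoeffSum_genPoly rest (by simpa using hps)).le
  | cons B blocks ih =>
      have hB : ∀ p ∈ B, 0 ≤ p ∧ p ≤ 1 := fun p hp => hps p (by simp [hp])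
      have hrest : ∀ p ∈ blocks.flatten ++ rest, 0 ≤ p ∧ p ≤ 1 := fun p hp => hps p (by
        simp only [List.flatten_cons, List.append_assoc, List.mem_append] at hp ⊢
        exact Or.inr hp)
      -- `(1−X)^{j+1} G_{B ++ rest'} = ((1−X) G_B) · ((1−X)^j G_{rest'})`
      have hfac : (1 - X) ^ (B :: blocks).length * (((B :: blocks).flatten ++ rest).map fun p => C (1 - p) + C p * X).prod =
          ((1 - X) * (B.map fun p => C (1 - p) + C p * X).prod) *
            ((1 - X) ^ blocks.length * ((blocks.flatten ++ rest).map fun p => C (1 - p) + C p * X).prod) := by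
        rw [List.length_cons, List.flatten_cons, List.append_assoc, genPoly_append, pow_succ]
        ring
      rw [hfac, List.map_cons, List.prod_cons]
      refine (absCoeffSum_mul_le _ _).trans ?_
      refine mul_le_mul_of_nonneg_left (ih hrest) (sum_nonneg fun i _ => abs_nonneg _)

/-- The variance functional `V(l) = Σ_{p∈l} p(1−p)` grows by at most `1/4` per parameter taken.
[cite: RollinRoss2010, §4.1 (proof of Thm 4.2: splitting the sum into blocks)] -/
theorem varSum_take_succ_le (l : List ℝ) (k : ℕ) :
    ((l.take (k + 1)).map fun p => p * (1 - p)).sum ≤ ((l.take k).map fun p => p * (1 - p)).sum + 1 / 4 := by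
  induction l generalizing k with
  | nil => simp
  | cons x l ih =>
      have hx : x * (1 - x) ≤ 1 / 4 := by nlinarith [sq_nonneg (x - 1 / 2)]
      rcases k with _ | k
      · simp; linarith
      · simp only [List.take_succ_cons, List.map_cons, List.sum_cons]
        linarith [ih k]

/-- `V` is additive over `take ++ drop`. [cite: RollinRoss2010, §4.1] -/
theorem varSum_take_add_drop (l : List ℝ) (k : ℕ) :
    ((l.take k).map fun p => p * (1 - p)).sum + ((l.drop k).map fun p => p * (1 - p)).sum =
      (l.map fun p => p * (1 - p)).sum := by
  rw [← List.sum_append, ← List.map_append, List.take_append_drop]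

/-- **Greedy prefix blocks**: if `θ > 0` and `j·θ + (j−1)/4 ≤ V(ps)` then `ps` splits (in order) into
`j` consecutive blocks each of variance `≥ θ`, followed by a remainder. [cite: RollinRoss2010, §4.1 Thm 4.2 (proof: blocks of comparable variance)] -/
theorem exists_prefix_blocks {θ : ℝ} (hθ : 0 < θ) :
    ∀ (j : ℕ) (ps : List ℝ), (j : ℝ) * θ + ((j : ℝ) - 1) / 4 ≤ (ps.map fun p => p * (1 - p)).sum →
      ∃ (blocks : List (List ℝ)) (rest : List ℝ), blocks.length = j ∧ blocks.flatten ++ rest = ps ∧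
        ∀ B ∈ blocks, θ ≤ (B.map fun p => p * (1 - p)).sum
  | 0, ps, _ => ⟨[], ps, rfl, by simp, by simp⟩
  | j + 1, ps, hV => by
      classical
      -- shortest prefix with variance `≥ θ`
      have hex : ∃ k, θ ≤ ((ps.take k).map fun p => p * (1 - p)).sum := by
        refine ⟨ps.length, ?_⟩
        rw [List.take_length]
        have : (0 : ℝ) ≤ (j : ℝ) * θ + (j : ℝ) / 4 := by positivity
        push_cast at hV
        linarith
      let k := Nat.find hex
      have hk : θ ≤ ((ps.take k).map fun p => p * (1 - p)).sum := Nat.find_spec hex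
      have hk1 : 1 ≤ k := by
        rcases Nat.eq_zero_or_pos k with h | h
        · have := hk; rw [h] at this; simp at this; linarith
        · exact h
      have hkmin : ((ps.take (k - 1)).map fun p => p * (1 - p)).sum < θ := lt_of_not_ge (Nat.find_min hex (by omega))
      have hkle : ((ps.take k).map fun p => p * (1 - p)).sum ≤ θ + 1 / 4 := by
        have := varSum_take_succ_le ps (k - 1)
        rw [show k - 1 + 1 = k by omega] at this
        linarith
      -- recurse on the suffix
      have hV' : (j : ℝ) * θ + ((j : ℝ) - 1) / 4 ≤ ((ps.drop k).map fun p => p * (1 - p)).sum := by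
        have := varSum_take_add_drop ps k
        push_cast at hV
        linarith
      obtain ⟨blocks, rest, hlen, hjoin, hθB⟩ := exists_prefix_blocks hθ j (ps.drop k) hV'
      refine ⟨ps.take k :: blocks, rest, by simp [hlen], ?_, ?_⟩
      · rw [List.flatten_cons, List.append_assoc, hjoin, List.take_append_drop]
      · intro B hB
        rcases List.mem_cons.1 hB with rfl | hB
        · exact hk
        · exact hθB B hB

/-! ## §4 The bound `D_j ≤ (C j / V)^{j/2}` -/

/-- **Röllin–Ross-type smoothness of a Poisson-binomial law**: for parameters in `[0,1]`, variance
`V = Σ p_k(1−p_k) > 0` and an order `1 ≤ j ≤ 2V + 1`, the total variation of the `j`-th difference of the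
law satisfies `‖(1 − X)^j G_{ps}‖₁ ≤ (2√192 · √(2j/V))^j` `( = (1536 j / V)^{j/2})`.
[cite: RollinRoss2010, §4.1 Thm 4.2 (the shape `D_k ≲ (Ck/V)^{k/2}` for sums of independent indicators)] -/
theorem absCoeffSum_one_sub_X_pow_mul_genPoly_le (ps : List ℝ) (hps : ∀ p ∈ ps, 0 ≤ p ∧ p ≤ 1) {j : ℕ}
    (hV : 0 < (ps.map fun p => p * (1 - p)).sum) (hj : (j : ℝ) - 1 ≤ 2 * (ps.map fun p => p * (1 - p)).sum) :
    ∑ i ∈ range (((1 - X) ^ j * (ps.map fun p => C (1 - p) + C p * X).prod).natDegree + 1),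
      |((1 - X) ^ j * (ps.map fun p => C (1 - p) + C p * X).prod).coeff i| ≤
      (2 * Real.sqrt 192 * Real.sqrt (2 * j / (ps.map fun p => p * (1 - p)).sum)) ^ j := by
  rcases Nat.eq_zero_or_pos j with rfl | hjpos
  · simp only [pow_zero, one_mul]
    exact (absCoeffSum_genPoly ps hps).le
  set V := (ps.map fun p => p * (1 - p)).sum with hVdef
  -- blocks of variance `≥ θ = V/(2j)`
  have hθ : 0 < V / (2 * j) := by positivity
  have hcond : (j : ℝ) * (V / (2 * j)) + ((j : ℝ) - 1) / 4 ≤ V := by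
    have hjr : (0 : ℝ) < j := by exact_mod_cast hjpos
    field_simp
    nlinarith
  obtain ⟨blocks, rest, hlen, hjoin, hθB⟩ := exists_prefix_blocks hθ j ps hcond
  have hps' : ∀ p ∈ blocks.flatten ++ rest, 0 ≤ p ∧ p ≤ 1 := by rw [hjoin]; exact hps
  have h := absCoeffSum_blocks_le_prod blocks rest hps'
  rw [hjoin, hlen] at h
  refine h.trans ?_
  -- each block factor `≤ 2√192/√θ`
  have hfac : ∀ B ∈ blocks, ∑ i ∈ range (((1 - X) * (B.map fun p => C (1 - p) + C p * X).prod).natDegree + 1),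
      |((1 - X) * (B.map fun p => C (1 - p) + C p * X).prod).coeff i| ≤ 2 * Real.sqrt 192 * Real.sqrt (2 * j / V) := by
    intro B hB
    have hBps : ∀ p ∈ B, 0 ≤ p ∧ p ≤ 1 := fun p hp => hps' p (List.mem_append_left _ (List.mem_flatten.2 ⟨B, hB, hp⟩))
    have hVB : V / (2 * j) ≤ (B.map fun p => p * (1 - p)).sum := hθB B hB
    have hVBpos : 0 < (B.map fun p => p * (1 - p)).sum := hθ.trans_le hVB
    refine (absCoeffSum_one_sub_X_mul_genPoly_le B hBps hVBpos).trans ?_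
    have h1 : 1 / Real.sqrt ((B.map fun p => p * (1 - p)).sum) ≤ Real.sqrt (2 * j / V) := by
      rw [one_div, ← Real.sqrt_inv, inv_eq_one_div]
      apply Real.sqrt_le_sqrt
      calc 1 / (B.map fun p => p * (1 - p)).sum ≤ 1 / (V / (2 * j)) := one_div_le_one_div_of_le hθ hVB
        _ = 2 * j / V := one_div_div _ _
    calc 2 * (Real.sqrt 192 / Real.sqrt ((B.map fun p => p * (1 - p)).sum))
        = 2 * Real.sqrt 192 * (1 / Real.sqrt ((B.map fun p => p * (1 - p)).sum)) := by ring
      _ ≤ 2 * Real.sqrt 192 * Real.sqrt (2 * j / V) := mul_le_mul_of_nonneg_left h1 (by positivity)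
  -- product of the block factors, each in `[0, 2√192·√(2j/V)]`
  have hprod : ∀ l : List (List ℝ), (∀ B ∈ l, B ∈ blocks) →
      (l.map fun B => ∑ i ∈ range (((1 - X) * (B.map fun p => C (1 - p) + C p * X).prod).natDegree + 1),
        |((1 - X) * (B.map fun p => C (1 - p) + C p * X).prod).coeff i|).prod ≤
        (2 * Real.sqrt 192 * Real.sqrt (2 * j / V)) ^ l.length := by
    intro l hl
    induction l with
    | nil => simp
    | cons B l ih =>
        rw [List.map_cons, List.prod_cons, List.length_cons, pow_succ']
        have hB : B ∈ blocks := hl B (by simp)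
        refine mul_le_mul (hfac B hB) (ih fun B' hB' => hl B' (by simp [hB'])) ?_ (by positivity)
        exact List.prod_nonneg fun x hx => by
          obtain ⟨B', _, rfl⟩ := List.mem_map.1 hx
          exact sum_nonneg fun i _ => abs_nonneg _
  have := hprod blocks fun B hB => hB
  rwa [hlen] at this

/-- The trivial bound `‖(1 − X)^j G_{ps}‖₁ ≤ 2^j`. [cite: RollinRoss2010, §3 Lemma 3.1 (`D_{n+1} ≤ 2D_n`)] -/
theorem absCoeffSum_one_sub_X_pow_mul_genPoly_le_two_pow (ps : List ℝ) (hps : ∀ p ∈ ps, 0 ≤ p ∧ p ≤ 1) (j : ℕ) :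
    ∑ i ∈ range (((1 - X) ^ j * (ps.map fun p => C (1 - p) + C p * X).prod).natDegree + 1),
      |((1 - X) ^ j * (ps.map fun p => C (1 - p) + C p * X).prod).coeff i| ≤ 2 ^ j := by
  induction j with
  | zero => simp only [pow_zero, one_mul]; exact (absCoeffSum_genPoly ps hps).le
  | succ j ih =>
      rw [pow_succ', mul_assoc, pow_succ']
      exact (absCoeffSum_one_sub_X_mul_le _).trans (mul_le_mul_of_nonneg_left ih zero_le_two)

/-! ## §5 The hypergeometric law -/

/-- **Röllin–Ross smoothness of the hypergeometric law**: with `V = r b d (b+d−r)/((b+d)²(b+d−1)) > 0`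
and `1 ≤ j ≤ 2V + 1`, `Σ_n |coeff_n((1 − X)^j H_{b,d,r})| ≤ C(b+d,r) · (2√192·√(2j/V))^j`, i.e. the
`j`-th difference of the hypergeometric probabilities has total variation `≤ (1536 j/V)^{j/2}`.
[cite: RollinRoss2010, §4.1 Thm 4.2 (shape `(Ck/V)^{k/2}`)] [cite: VatutinMikhailov1983, §2] -/
theorem hypergeometric_absCoeffSum_le {b d r : ℕ} (hr : r ≤ b + d) {j : ℕ}
    (hV : 0 < (r : ℝ) * b * d * ((b : ℝ) + d - r) / (((b : ℝ) + d) ^ 2 * ((b : ℝ) + d - 1)))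
    (hj : (j : ℝ) - 1 ≤ 2 * ((r : ℝ) * b * d * ((b : ℝ) + d - r) / (((b : ℝ) + d) ^ 2 * ((b : ℝ) + d - 1)))) :
    ∑ i ∈ range (((1 - X) ^ j * hyperGen b d r).natDegree + 1), |((1 - X) ^ j * hyperGen b d r).coeff i| ≤
      ((b + d).choose r : ℝ) * (2 * Real.sqrt 192 * Real.sqrt (2 * j /
        ((r : ℝ) * b * d * ((b : ℝ) + d - r) / (((b : ℝ) + d) ^ 2 * ((b : ℝ) + d - 1))))) ^ j := by
  obtain ⟨ps, hps, hlen, hfac⟩ := exists_bernoulliProd_eq_hyperGen hr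
  have hmem : ∀ p ∈ ps, 0 ≤ p ∧ p ≤ 1 := fun p hp => ⟨(hps p hp).1.le, (hps p hp).2⟩
  have hvs := sum_mul_one_sub_eq_of_hyperGen_eq hr hlen hfac
  rw [← hvs] at hV hj ⊢
  have hmain := absCoeffSum_one_sub_X_pow_mul_genPoly_le ps hmem hV hj
  have hfac' : (1 - X) ^ j * hyperGen b d r =
      C (((b + d).choose r : ℕ) : ℝ) * ((1 - X) ^ j * (ps.map fun p => C (1 - p) + C p * X).prod) := by
    rw [hfac]; ring
  have hc0 : (0 : ℝ) ≤ (((b + d).choose r : ℕ) : ℝ) := by positivity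
  have hdeg : (C (((b + d).choose r : ℕ) : ℝ) * ((1 - X) ^ j * (ps.map fun p => C (1 - p) + C p * X).prod)).natDegree ≤
      ((1 - X) ^ j * (ps.map fun p => C (1 - p) + C p * X).prod).natDegree := natDegree_C_mul_le _ _
  rw [hfac', absCoeffSum_eq_of_le _ hdeg]
  simp only [coeff_C_mul, abs_mul, abs_of_nonneg hc0, ← mul_sum]
  exact mul_le_mul_of_nonneg_left hmain hc0

/-- The trivial companion `Σ_n |coeff_n((1 − X)^j H_{b,d,r})| ≤ C(b+d,r) · 2^j`.
[cite: RollinRoss2010, §3 Lemma 3.1] [cite: VatutinMikhailov1983, §2] -/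
theorem hypergeometric_absCoeffSum_le_two_pow {b d r : ℕ} (hr : r ≤ b + d) (j : ℕ) :
    ∑ i ∈ range (((1 - X) ^ j * hyperGen b d r).natDegree + 1), |((1 - X) ^ j * hyperGen b d r).coeff i| ≤
      ((b + d).choose r : ℝ) * 2 ^ j := by
  obtain ⟨ps, hps, _, hfac⟩ := exists_bernoulliProd_eq_hyperGen hr
  have hmem : ∀ p ∈ ps, 0 ≤ p ∧ p ≤ 1 := fun p hp => ⟨(hps p hp).1.le, (hps p hp).2⟩
  have hmain := absCoeffSum_one_sub_X_pow_mul_genPoly_le_two_pow ps hmem j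
  have hfac' : (1 - X) ^ j * hyperGen b d r =
      C (((b + d).choose r : ℕ) : ℝ) * ((1 - X) ^ j * (ps.map fun p => C (1 - p) + C p * X).prod) := by
    rw [hfac]; ring
  have hc0 : (0 : ℝ) ≤ (((b + d).choose r : ℕ) : ℝ) := by positivity
  have hdeg : (C (((b + d).choose r : ℕ) : ℝ) * ((1 - X) ^ j * (ps.map fun p => C (1 - p) + C p * X).prod)).natDegree ≤
      ((1 - X) ^ j * (ps.map fun p => C (1 - p) + C p * X).prod).natDegree := natDegree_C_mul_le _ _
  rw [hfac', absCoeffSum_eq_of_le _ hdeg]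
  simp only [coeff_C_mul, abs_mul, abs_of_nonneg hc0, ← mul_sum]
  exact mul_le_mul_of_nonneg_left hmain hc0

end PoissonBinomial

end Literature.Probability.Distributions
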